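import Literature.NumberTheory.ComplexMultiplication.EllipticUnits.ImaginaryQuadraticMainConjectureClassGroupRowGlue
import Literature.NumberTheory.ComplexMultiplication.EllipticUnits.ImaginaryQuadraticMainConjectureLayerDualityInstance
import HarnessLib

/-!
# The class-group row of Johnson-Leung–Kings 2011, Lemma 5.8 — the RANGE of `Φ : C.X →ₗ[Λ₂] I.H` without a gluing hypothesis,
# and the reduction of `hfcoker` to the LOCAL plug (π4b)

Topic `Literature/NumberTheory/ComplexMultiplication/EllipticUnits` (grouping sub-namespace `JohnsonLeungKings2011.ClassGroupRow`).
Cell `bsd-print-cf2`, width seat `bsd-line-cf2c-w8` g9 (prover).  Sequel of `…ClassGroupRowGlue.lean` ((π4a): `hglue` discharged,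
`exists_character_comp_iota_eq`) and `…LayerDualityInstance.lean` (the class-group row `Φ` with `classGroupRow_mem_range_iff_of_glue`).
THEOREMS ONLY (no definition, no named fact, no instance, no `sorry`).

* `unitChar_eq_one_or_eq_neg_one_of_sq` — a quadratic `θ` (`θ(σ)² = 1`) has `unitChar θ = ±1` (the frame's `hθ2` ⟹ `hθH`).
* **`classGroupRow_mem_range_iff`** — for `θ = ±1` on `Gal(K̄/K̃_∞)`: `y ∈ range Φ ↔ ∀ n k, proj_{n,k} y ∈ Ш²_S(K̃_n, μ_{p^k} ⊗ θ′)`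
  (JLK Lemma 5.8: the cokernel of the class-group row embeds in `∏_{n,k} H²(G_S(K̃_n), ·)/Ш²_S ↪` the local `H²`'s), i.e.
  `classGroupRow_mem_range_iff_of_glue` with its `hglue` binder DISCHARGED by `exists_character_comp_iota_eq`.
* **`classGroupRow_hfcoker_of_local`** — the `hfcoker` binder of the cell's abstract descent lemma
  (`…Theorems.PrintCf2.JLKDescent.exists_charIdeal_mul_pow_eq_of_zetaSkeleton`: «at every `𝔭` of height `≤ 1` with `p ∉ 𝔭`, every
  `y : I.H` has `r • y ∈ range Φ` for some `r ∉ 𝔭`») REDUCED to the local plug (π4b) «`∃ r ∉ 𝔭, ∀ n k, proj_{n,k}(r • y) ∈ Ш²_S`»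
  (local `H²` in the limit), stated for an arbitrary predicate on the scalars so that the consumer's `𝔭`-quantifier is untouched.

HONEST FRAMING: bookkeeping over the socket; conditional (as the whole row) on the displayed Poitou–Tate fact `h`; no main conjecture,
no case of BSD is proved here; no summit statement is proved by this seat.

## References
* J. Johnson-Leung, G. Kings, J. reine angew. Math. 653 (2011) = arXiv:0804.2828, §5.4 Lemma 5.8 and its proof
  (p0015:L150–p0016:L20). [JohnsonLeungKings2011]
* J. S. Milne, *Arithmetic Duality Theorems*, 2nd ed. (2006), I Thm. 4.10 (a), I §4 p. 65. [MilneADT2006]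
* L. Keller, H. Yin (2024), §1.1. [KellerYin2024]
-/

noncomputable section

open scoped NumberField
open CategoryTheory Field IsDedekindDomain
open Literature.NumberTheory.GaloisRepresentations
open Literature.NumberTheory.GaloisRepresentations.DiscreteGaloisModule
open Literature.NumberTheory.GaloisCohomology Literature.NumberTheory.GaloisCohomology.ShaLayer
open Literature.NumberTheory.EllipticCurves Literature.NumberTheory.EllipticCurves.KellerYin2024
open Literature.NumberTheory.ComplexMultiplication.EllipticUnits.Rubin1991

namespace Literature.NumberTheory.ComplexMultiplication.EllipticUnits.JohnsonLeungKings2011.ClassGroupRow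

variable {K : Type} [Field K] [NumberField K] {p : ℕ} [Fact p.Prime]
  {κ₁ κ₂ : ZpExtension K p} {θ : FramedGaloisRep K (padicCoeffIntegers (∅ : Set (PadicAlgCl p))) 1}
  {θ' : absoluteGaloisGroup K →ₜ* ℤ_[p]ˣ} {𝔣 : Ideal (𝓞 K)}

/-! ## §1 Quadratic characters are `±1`-valued -/

omit [NumberField K] in
/-- A quadratic `θ` (`θ(σ)² = 1` for all `σ`) has `unitChar θ σ ∈ {1, −1}` (`ℤ_p` is a domain); in particular
`unitChar θ = ±1` on `Gal(K̄/K̃_∞)` — the hypothesis `hθH` of `exists_character_comp_iota_eq`. [cite: KellerYin2024, §1.1 (arXiv:2402.12781v2 TeX L441–449)] -/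
theorem unitChar_eq_one_or_eq_neg_one_of_sq (hθ2 : ∀ σ : absoluteGaloisGroup K, θ σ ^ 2 = 1) (σ : absoluteGaloisGroup K) :
    unitChar θ σ = 1 ∨ unitChar θ σ = -1 := by
  have h : ((unitChar θ σ : ℤ_[p]ˣ) : ℤ_[p]) ^ 2 = 1 := by
    rw [← Units.val_pow_eq_pow_val, unitChar_pow_eq_one θ hθ2 σ, Units.val_one]
  rcases sq_eq_one_iff.mp h with h1 | h1
  · exact Or.inl (Units.ext h1)
  · exact Or.inr (Units.ext (by rw [h1, Units.val_neg, Units.val_one]))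

/-! ## §2 The range of the class-group row, unconditionally in `hglue` -/

section Range

variable [hFin : ∀ n : ℕ, Fintype (absoluteGaloisGroup K ⧸ pairLayerSubgroup κ₁ κ₂ n)]
  {h : poitouTate_shaRestricted_tateDual_natural_at K (suppPF p 𝔣)}
  {hθ : ∀ σ : absoluteGaloisGroup K, ((θ' σ : ℤ_[p]ˣ) : ℤ_[p]) * ((unitChar θ σ : ℤ_[p]ˣ) : ℤ_[p]) = 1}
  {hV : ∀ n : ℕ, ramificationSubgroup K (suppPF p 𝔣) ≤ pairLayerSubgroup κ₁ κ₂ n}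
  {hμ : ∀ k : ℕ, ramificationSubgroup K (suppPF p 𝔣) ≤ ContinuousRep.ker (muTwist p θ' k)}
  {hZ : ∀ k : ℕ, ramificationSubgroup K (suppPF p 𝔣) ≤ ContinuousRep.ker (zmodTwist p (unitChar θ) k)}
  {η₁ η₂ : absoluteGaloisGroup K} {C : ClassGroupDualData₂ κ₁ κ₂ θ η₁ η₂}
  {I : IwasawaCohomologyData p κ₁ κ₂ η₁ η₂ θ' 𝔣 2} {Φ : C.X →ₗ[IwasawaAlgebra₂ p] I.H}
  (hΦ : ∀ (n k : ℕ) (x : C.X),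
    ∃ hx : I.proj n k (Φ x) ∈ layerShaRestricted (suppPF p 𝔣) (muTwist p θ' k) (pairLayerSubgroup κ₁ κ₂ n) 2,
      ∀ z : shaOne p κ₁ κ₂ θ 𝔣 n k,
        pair p κ₁ κ₂ θ θ' 𝔣 h hθ hV hμ hZ n k ⟨I.proj n k (Φ x), hx⟩ z = C.toDual x (iota p κ₁ κ₂ θ 𝔣 n k z))
  (hθH : ∀ g ∈ ZpExtension.pairKer κ₁ κ₂, unitChar θ g = 1 ∨ unitChar θ g = -1)
include hΦ hθH

/-- **RANGE of the class-group row (JLK Lemma 5.8), `hglue` discharged**: for `θ = ±1` on `Gal(K̄/K̃_∞)`,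
`y ∈ range Φ ↔` every `proj_{n,k} y ∈ Ш²_S(K̃_n, μ_{p^k} ⊗ θ′)` — so `coker Φ ↪ ∏_{n,k} H²(G_S(K̃_n), ·)/Ш²_S`, which embeds in the
local `H²`'s. [cite: JohnsonLeungKings2011, §5.4 Lemma 5.8 and its proof (arXiv p0015:L150–p0016:L20)] [cite: MilneADT2006, I Thm. 4.10 (a), I §4 p. 65] -/
theorem classGroupRow_mem_range_iff (y : I.H) :
    y ∈ LinearMap.range Φ ↔
      ∀ n k : ℕ, I.proj n k y ∈ layerShaRestricted (suppPF p 𝔣) (muTwist p θ' k) (pairLayerSubgroup κ₁ κ₂ n) 2 :=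
  classGroupRow_mem_range_iff_of_glue hΦ
    (fun χ hχres hχincl => exists_character_comp_iota_eq p κ₁ κ₂ θ 𝔣 hV hZ hθH χ hχres hχincl) y

/-- **`hfcoker` of the class-group row REDUCED TO THE LOCAL PLUG (π4b)**: for any predicate `P` on the scalars (meant:
`r ∉ 𝔭` for a prime `𝔭` of height `≤ 1` with `p ∉ 𝔭`), if some `r` with `P r` puts all `proj_{n,k}(r • y)` in `Ш²_S`, then some
`r` with `P r` has `r • y ∈ range Φ` — the `hfcoker` binder of the cell's abstract descent lemma, pointwise in `𝔭`.
[cite: JohnsonLeungKings2011, §5.4 Lemma 5.8 and its proof (arXiv p0015:L150–p0016:L20)] -/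
theorem classGroupRow_hfcoker_of_local (P : IwasawaAlgebra₂ p → Prop) (y : I.H)
    (hloc : ∃ r : IwasawaAlgebra₂ p, P r ∧
      ∀ n k : ℕ, I.proj n k (r • y) ∈ layerShaRestricted (suppPF p 𝔣) (muTwist p θ' k) (pairLayerSubgroup κ₁ κ₂ n) 2) :
    ∃ r : IwasawaAlgebra₂ p, P r ∧ r • y ∈ LinearMap.range Φ := by
  obtain ⟨r, hr, hmem⟩ := hloc
  exact ⟨r, hr, (classGroupRow_mem_range_iff hΦ hθH (r • y)).mpr hmem⟩

end Range

end Literature.NumberTheory.ComplexMultiplication.EllipticUnits.JohnsonLeungKings2011.ClassGroupRow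

end
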